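import Literature.NumberTheory.Transcendental.HolonomyBoundBox
import Mathlib.Analysis.SpecialFunctions.Pow.Asymptotics
import Mathlib.Analysis.SpecialFunctions.Log.Basic
import Mathlib.Tactic
import HarnessLib

/-!
# The basic arithmetic holonomy bound (Calegari–Dimitrov–Tang, Appendix §17), holomorphic case

**Theorem (CDT 2024, Appendix §17, eq. (PZ final), with `u = h = 1`).** Let
`f₁, …, f_m ∈ ℚ⟦x⟧` be of denominator type `(b₁,…,b_r)`,
`fᵢ = Σₙ a_{i,n} xⁿ / ([1,…,b₁n]⋯[1,…,b_r n])`, `a_{i,n} ∈ ℤ`, linearly independent over `ℚ(x)`.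
Let `φ` be holomorphic on a neighbourhood of the closed unit disc with `φ(0) = 0`, and suppose
that each pullback `φ^* fᵢ` extends to a holomorphic function `gᵢ` on that neighbourhood. Then
`m ≤ 2 · sup_𝕋 log⁺|φ| / (log|φ'(0)| − b₁ − ⋯ − b_r)`
whenever the denominator is positive. Here it is stated in the division-free form
`m · (log|φ'(0)| − Σ bⱼ) ≤ 2 log M` for any bound `M ≥ 1` of `|φ|` on the unit circle (so with
`M = max(1, sup_𝕋 |φ|)`, `log M = sup_𝕋 log⁺|φ|`; when the denominator is `≤ 0` the statement is
vacuous-true).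

This is the single-variable "dynamic box principle" proof of CDT's Appendix §17 (after
Perelli–Zannier), the most elementary of the arithmetic holonomy bounds of that paper: the
case `u = h = 1` of eq. (PZ final) `m ≤ 2 sup_𝕋 log max(|u|,|v|) / (log|φ'(0)| − Σbᵢ)`, which with
Nevanlinna's lemma gives eq. (basic basic) `m ≤ 2T(φ)/(log|φ'(0)| − Σbᵢ)`; it refines the bound
`e · ∫ log⁺|φ| / log|φ'(0)|` of [UDC] (CDT 2021) quoted as eq. (original UDC bound) in §2.1.
The meromorphic refinements (`φ = v/u`, the factor `h`, the characteristic `T(φ)`) are not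
formalised in this file.

Proof (pp. 129–130): with the jumps `u(1) < ⋯ < u(mD)` (`HolonomyBoundJumps`), the box
inequality `T^{mD} ≤ Π_p (1 + 2A_p den(u(p)))` (`HolonomyBoundBox`), the choice of `T` making
every factor `≥ 2`, the Gauss sum `Σ u(p) ≥ (mD choose 2)`, the prime number theorem for the
denominators (`HolonomyBoundDen`), and the limits `D → ∞`, `ε → 0`. This endgame is run on an
abstract Cauchy-type estimate `|β| ρⁿ ≤ m T D M^D G` for the lowest coefficient of an output
(`HolonomyBound.holonomyBound_of_coeff_bound`, giving `m (log ρ − Σ bⱼ) ≤ 2 log M`), so that the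
meromorphic refinements only need to supply their own estimate; the holomorphic case
(`HolonomyBound.holonomyBound_basic`) plugs in `HolonomyBoundGerms.norm_coeff_combo_mul_pow_le`.

## References

* [CalegariDimitrovTang2024] arXiv:2408.15403, Appendix §17, eqs. (PZ final), (basic basic),
  (PZ penultimate) (pp. 129–130); §2.1 eq. (original UDC bound).
-/

noncomputable section

open Filter Metric Finset PowerSeries
open scoped Topology

namespace Literature.NumberTheory.Transcendental

namespace HolonomyBound

variable {m r : ℕ}

/-- A strictly increasing `ℕ`-valued enumeration dominates the identity: `p ≤ u p`.
[folklore] -/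
theorem le_of_strictMono {N : ℕ} {u : Fin N → ℕ} (hu : StrictMono u) (p : Fin N) :
    (p : ℕ) ≤ u p := by
  obtain ⟨k, hk⟩ := p
  induction k with
  | zero => exact Nat.zero_le _
  | succ k ih =>
    have hk' : k < N := Nat.lt_of_succ_lt hk
    have h1 : k ≤ u ⟨k, hk'⟩ := ih hk'
    have h2 : u ⟨k, hk'⟩ < u ⟨k + 1, hk⟩ := hu (Fin.mk_lt_mk.mpr (Nat.lt_succ_self k))
    simp only
    omega

/-- The Gauss sum bound `Σ_p u p ≥ N(N−1)/2` for a strictly increasing `u : Fin N → ℕ`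
(CDT eq. (Gauss sum): "`Σ u(p) ≥ Σ_{n<mD} n = (mD choose 2)`").
[cite: CalegariDimitrovTang2024, Appendix §17.3 eq. (Gauss sum) (p. 130)] -/
theorem gauss_sum_le {N : ℕ} {u : Fin N → ℕ} (hu : StrictMono u) :
    (N : ℝ) * (N - 1) / 2 ≤ ∑ p : Fin N, (u p : ℝ) := by
  have h1 : ∑ p : Fin N, ((p : ℕ) : ℝ) ≤ ∑ p : Fin N, (u p : ℝ) :=
    Finset.sum_le_sum fun p _ => by exact_mod_cast le_of_strictMono hu p
  have h2 : ∑ p : Fin N, ((p : ℕ) : ℝ) = (N : ℝ) * (N - 1) / 2 := by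
    have h := Finset.sum_range_id_mul_two N
    have h' : ((∑ i ∈ range N, i : ℕ) : ℝ) * 2 = (N : ℝ) * ((N - 1 : ℕ) : ℝ) := by
      exact_mod_cast h
    rw [Fin.sum_univ_eq_sum_range (fun i => ((i : ℕ) : ℝ)) N]
    push_cast at h' ⊢
    rcases Nat.eq_zero_or_pos N with rfl | hN
    · simp
    · rw [Nat.cast_sub hN] at h'
      push_cast at h'
      linarith
  linarith

/-- **The dynamic box principle, abstract form** (CDT Appendix §17, the endgame of pp. 129–130
run on an abstract Cauchy-type estimate): let `f₁,…,f_m ∈ ℚ⟦x⟧` be of denominator type `b`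
(`fᵢ = Σ a i k/den b k · x^k`) and `ℚ(x)`-linearly independent (injectivity of every `ψ_D`).
Suppose `ρ ≥ 0`, `M ≥ 1`, `G` are such that for all `D`, all real `T ≥ 1` and all
`c : Fin m → Fin D → ℚ` with `|c i j| ≤ T`, the lowest non-zero coefficient `β` (at `xⁿ`) of
`W c = Σ c i j • X^j fᵢ` satisfies `|β| ρⁿ ≤ m·T·D·M^D·G` (CDT eq. (sup bound) with
`ρ = |φ'(0)|`, `M = sup_𝕋 max(|u|,|v|)`, `G = sup_𝕋 |h φ^*fᵢ|`). Then
`m · (log ρ − Σ_j b_j) ≤ 2 · log M` (eq. (PZ final) in division-free form).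
[cite: CalegariDimitrovTang2024, Appendix §17 eqs. (PZ penultimate), (PZ final) (p. 130)] -/
theorem holonomyBound_of_coeff_bound (b : Fin r → ℕ) (a : Fin m → ℕ → ℤ)
    (hindep : ∀ D : ℕ, LinearIndependent ℚ (genFamily b a D))
    {ρ M G : ℝ} (hρ0 : 0 ≤ ρ) (hM1 : 1 ≤ M)
    (hbound : ∀ (D : ℕ) (T : ℝ), 1 ≤ T → ∀ c : Fin m → Fin D → ℚ, (∀ i j, |(c i j : ℝ)| ≤ T) →
      ∀ n, (∀ k < n, coeff k (combo (cfOf b a) c) = 0) →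
        |((coeff n (combo (cfOf b a) c) : ℚ) : ℝ)| * ρ ^ n ≤ m * T * D * M ^ D * G) :
    (m : ℝ) * (Real.log ρ - ∑ j, (b j : ℝ)) ≤ 2 * Real.log M := by
  classical
  set B : ℝ := ∑ j, (b j : ℝ) with hBdef
  set θ : ℝ := Real.log ρ - B with hθdef
  have hlogM : 0 ≤ Real.log M := Real.log_nonneg hM1
  have hB0 : 0 ≤ B := Finset.sum_nonneg fun j _ => Nat.cast_nonneg _
  -- trivial cases
  rcases le_or_gt θ 0 with hθ0 | hθpos
  · calc (m : ℝ) * θ ≤ 0 := mul_nonpos_of_nonneg_of_nonpos (Nat.cast_nonneg _) hθ0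
      _ ≤ 2 * Real.log M := by positivity
  rcases Nat.eq_zero_or_pos m with rfl | hm
  · simp only [Nat.cast_zero, zero_mul]; positivity
  -- `ρ > 0` (else `θ = -B ≤ 0`)
  have hρ : 0 < ρ := by
    by_contra h
    have hρ0' : ρ = 0 := le_antisymm (not_lt.mp h) hρ0
    rw [hθdef, hρ0', Real.log_zero, zero_sub] at hθpos
    linarith
  have hmR : (0 : ℝ) < m := by exact_mod_cast hm
  -- the bound with `G₁ = max G 1`
  set G₁ : ℝ := max G 1 with hG₁
  have hG₁1 : 1 ≤ G₁ := le_max_right _ _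
  have hM0 : 0 ≤ M := zero_le_one.trans hM1
  have hbound₁ : ∀ (D : ℕ) (T : ℝ), 1 ≤ T → ∀ c : Fin m → Fin D → ℚ,
      (∀ i j, |(c i j : ℝ)| ≤ T) → ∀ n, (∀ k < n, coeff k (combo (cfOf b a) c) = 0) →
        |((coeff n (combo (cfOf b a) c) : ℚ) : ℝ)| * ρ ^ n ≤ m * T * D * M ^ D * G₁ := by
    intro D T hT c hc n hn
    refine (hbound D T hT c hc n hn).trans ?_
    have h0 : (0 : ℝ) ≤ m * T * D * M ^ D := by
      have : (0 : ℝ) ≤ T := zero_le_one.trans hT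
      positivity
    exact mul_le_mul_of_nonneg_left (le_max_left _ _) h0
  -- it suffices to prove `m (θ - ε) ≤ 2 log M` for all small `ε > 0`
  suffices key : ∀ ε : ℝ, 0 < ε → ε < θ → (m : ℝ) * (θ - ε) ≤ 2 * Real.log M by
    apply le_of_forall_pos_le_add
    intro δ hδ
    have hε : 0 < min (θ / 2) (δ / m) := lt_min (by linarith) (div_pos hδ hmR)
    have h := key (min (θ / 2) (δ / m)) hε (lt_of_le_of_lt (min_le_left _ _) (by linarith))
    have h2 : (m : ℝ) * min (θ / 2) (δ / m) ≤ δ := by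
      calc (m : ℝ) * min (θ / 2) (δ / m) ≤ m * (δ / m) :=
            mul_le_mul_of_nonneg_left (min_le_right _ _) hmR.le
        _ = δ := by field_simp
    nlinarith
  intro ε hε hεθ
  set θ' : ℝ := θ - ε with hθ'
  have hθ'0 : 0 < θ' := by rw [hθ']; linarith
  -- denominators: `den b n ≤ C exp((B + ε) n)`
  obtain ⟨C, hC1, hC⟩ := exists_den_le_exp b hε
  set K : ℝ := 2 * m * G₁ * C with hK
  have hK1 : 1 ≤ K := by
    rw [hK]
    have h1 : (1 : ℝ) ≤ m := by exact_mod_cast hm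
    have h2 : (1 : ℝ) ≤ (m : ℝ) * G₁ := one_le_mul_of_one_le_of_one_le h1 hG₁1
    have h3 : (1 : ℝ) ≤ (m : ℝ) * G₁ * C := one_le_mul_of_one_le_of_one_le h2 hC1
    linarith
  have hK0 : 0 < K := by linarith
  -- the inequality for each `D ≥ 1`: `θ' (m D - 1) ≤ 2 log (2 K D) + 2 D log M`
  have hD : ∀ D : ℕ, 1 ≤ D →
      θ' * ((m : ℝ) * D - 1) ≤ 2 * Real.log (2 * K * D) + 2 * D * Real.log M := by
    intro D hD1
    have hDR : (1 : ℝ) ≤ D := by exact_mod_cast hD1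
    -- the jumps
    obtain ⟨u, hu, -, hu_all⟩ := exists_strictMono_orders (genFamily b a D) (hindep D)
    have hNmD : Fintype.card (Fin m × Fin D) = m * D := by
      rw [Fintype.card_prod, Fintype.card_fin, Fintype.card_fin]
    have hN1 : 1 ≤ Fintype.card (Fin m × Fin D) := by
      rw [hNmD]; exact Nat.one_le_iff_ne_zero.mpr (Nat.mul_ne_zero hm.ne' (by omega))
    -- the parameter `T`
    set U : ℕ := Finset.univ.sup u with hU
    have hUp : ∀ p, u p ≤ U := fun p => Finset.le_sup (Finset.mem_univ p)
    set T : ℕ := ⌈Real.exp (θ' * U)⌉₊ + 1 with hT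
    have hT1 : 1 ≤ T := Nat.le_add_left 1 _
    have hTR : Real.exp (θ' * U) ≤ T := by
      rw [hT]; push_cast
      linarith [Nat.le_ceil (Real.exp (θ' * U))]
    have hT0 : (0 : ℝ) < T := by exact_mod_cast hT1
    -- the box inequality
    have hTR1 : (1 : ℝ) ≤ (T : ℝ) := by exact_mod_cast hT1
    have hKD : (0 : ℝ) ≤ m * T * D * M ^ D * G₁ := by
      have : (0 : ℝ) ≤ G₁ := zero_le_one.trans hG₁1
      positivity
    have hbox := box_inequality b a (hindep D) hρ hKD
      (fun c hc n hn => hbound₁ D T hTR1 c hc n hn) hu hu_all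
    -- bound each factor by `2 x_p`, `x_p = K T D M^D exp(-θ' u p)`
    set x : Fin (Fintype.card (Fin m × Fin D)) → ℝ :=
      fun p => K * T * D * M ^ D * Real.exp (-(θ' * u p)) with hx
    have hMD : (1 : ℝ) ≤ M ^ D := one_le_pow₀ hM1
    have hx1 : ∀ p, 1 ≤ x p := by
      intro p
      have h1 : (1 : ℝ) ≤ Real.exp (θ' * U) * Real.exp (-(θ' * u p)) := by
        rw [← Real.exp_add, Real.one_le_exp_iff]
        have : (u p : ℝ) ≤ U := by exact_mod_cast hUp p
        nlinarith
      calc (1 : ℝ) ≤ Real.exp (θ' * U) * Real.exp (-(θ' * u p)) := h1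
        _ = 1 * Real.exp (θ' * U) * 1 * 1 * Real.exp (-(θ' * u p)) := by ring
        _ ≤ K * T * D * M ^ D * Real.exp (-(θ' * u p)) := by
            gcongr
    have hρu : ∀ n : ℕ, ρ ^ n = Real.exp (n * Real.log ρ) := by
      intro n
      rw [← Real.exp_log (pow_pos hρ n), Real.log_pow]
    have hfac : ∀ p, 2 * ((m : ℝ) * T * D * M ^ D * G₁ / ρ ^ (u p)) * den b (u p) + 1 ≤
        2 * x p := by
      intro p
      have hden := hC (u p)
      have hexp : Real.exp ((B + ε) * (u p)) / ρ ^ (u p) = Real.exp (-(θ' * u p)) := by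
        rw [hρu, ← Real.exp_sub]
        congr 1
        rw [hθ', hθdef]
        ring
      have h1 : 2 * ((m : ℝ) * T * D * M ^ D * G₁ / ρ ^ (u p)) * den b (u p) ≤ x p := by
        calc 2 * ((m : ℝ) * T * D * M ^ D * G₁ / ρ ^ (u p)) * den b (u p)
            ≤ 2 * ((m : ℝ) * T * D * M ^ D * G₁ / ρ ^ (u p)) *
                (C * Real.exp ((∑ j, (b j : ℝ) + ε) * (u p))) := by
              gcongr
          _ = (2 * m * G₁ * C) * T * D * M ^ D * (Real.exp ((B + ε) * (u p)) / ρ ^ (u p)) := by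
              rw [hBdef]; ring
          _ = x p := by rw [hexp, hx, hK]
      linarith [hx1 p]
    -- hence `T^{mD} ≤ (2 K T D M^D)^N exp(-θ' Σ u p)`
    set Su : ℝ := ∑ p, (u p : ℝ) with hSu
    have hprod : ∏ p, (2 * ((m : ℝ) * T * D * M ^ D * G₁ / ρ ^ (u p)) * den b (u p) + 1) ≤
        ∏ p, 2 * x p :=
      Finset.prod_le_prod (fun p _ => by positivity) fun p _ => hfac p
    have hprod2 : ∏ p, 2 * x p =
        (2 * K * T * D * M ^ D) ^ (Fintype.card (Fin m × Fin D)) * Real.exp (-(θ' * Su)) := by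
      have hxp : ∀ p, 2 * x p = (2 * K * T * D * M ^ D) * Real.exp (-(θ' * u p)) := fun p => by
        simp only [hx]; ring
      simp_rw [hxp]
      rw [Finset.prod_mul_distrib, Finset.prod_const, Finset.card_univ, Fintype.card_fin,
        ← Real.exp_sum, Finset.sum_neg_distrib, ← Finset.mul_sum]
    have h1 : (T : ℝ) ^ (m * D) ≤
        (2 * K * T * D * M ^ D) ^ (Fintype.card (Fin m × Fin D)) * Real.exp (-(θ' * Su)) :=
      hbox.trans (hprod.trans hprod2.le)
    -- cancel `T^{mD}` and take logarithms: `θ' Su ≤ N log (2 K D M^D)`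
    have hbase : 0 < 2 * K * D * M ^ D := by positivity
    have hkey : Real.exp (θ' * Su) ≤ (2 * K * D * M ^ D) ^ (Fintype.card (Fin m × Fin D)) := by
      rw [hNmD] at h1
      have h2 : (2 * K * T * D * M ^ D) ^ (m * D) =
          (2 * K * D * M ^ D) ^ (m * D) * (T : ℝ) ^ (m * D) := by
        rw [← mul_pow]; ring_nf
      rw [h2, Real.exp_neg] at h1
      have hE : 0 < Real.exp (θ' * Su) := Real.exp_pos _
      have h3 := (le_mul_inv_iff₀ hE).mp h1
      have hTk : (0 : ℝ) < (T : ℝ) ^ (m * D) := by positivity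
      rw [hNmD]
      refine le_of_mul_le_mul_left ?_ hTk
      calc (T : ℝ) ^ (m * D) * Real.exp (θ' * Su)
          ≤ (2 * K * D * M ^ D) ^ (m * D) * (T : ℝ) ^ (m * D) := h3
        _ = (T : ℝ) ^ (m * D) * (2 * K * D * M ^ D) ^ (m * D) := mul_comm _ _
    have hlog : θ' * Su ≤
        (Fintype.card (Fin m × Fin D) : ℕ) * (Real.log (2 * K * D) + D * Real.log M) := by
      have h2 := (Real.le_log_iff_exp_le (pow_pos hbase _)).mpr hkey
      rw [Real.log_pow, Real.log_mul (by positivity) (by positivity), Real.log_pow] at h2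
      exact h2
    -- the Gauss sum and the conclusion for this `D`
    set Nr : ℝ := ((Fintype.card (Fin m × Fin D) : ℕ) : ℝ) with hNr
    have hgauss : Nr * (Nr - 1) / 2 ≤ Su := gauss_sum_le hu
    have hNpos : (0 : ℝ) < Nr := by rw [hNr]; exact_mod_cast hN1
    have h4 : Nr * (θ' * (Nr - 1) / 2) ≤ Nr * (Real.log (2 * K * D) + D * Real.log M) := by
      calc Nr * (θ' * (Nr - 1) / 2) = θ' * (Nr * (Nr - 1) / 2) := by ring
        _ ≤ θ' * Su := mul_le_mul_of_nonneg_left hgauss hθ'0.le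
        _ ≤ Nr * (Real.log (2 * K * D) + D * Real.log M) := hlog
    have h5 := le_of_mul_le_mul_left h4 hNpos
    have hNR : Nr = m * D := by rw [hNr, hNmD]; push_cast; ring
    rw [hNR] at h5
    linarith
  -- conclude by `D → ∞`
  have hlim : Tendsto (fun D : ℕ => 2 * Real.log M +
      ((2 * Real.log (2 * K) + θ') / D + 2 * (Real.log (D : ℝ) / (D : ℝ)))) atTop
      (𝓝 (2 * Real.log M)) := by
    have h1 : Tendsto (fun D : ℕ => Real.log (D : ℝ) / (D : ℝ)) atTop (𝓝 0) := by
      have h := Real.tendsto_pow_log_div_mul_add_atTop 1 0 1 one_ne_zero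
      simp only [pow_one, one_mul, add_zero] at h
      exact h.comp tendsto_natCast_atTop_atTop
    have h2 : Tendsto (fun D : ℕ => (2 * Real.log (2 * K) + θ') / (D : ℝ)) atTop (𝓝 0) :=
      tendsto_const_div_atTop_nhds_zero_nat _
    have h3 := (h2.add (h1.const_mul 2)).const_add (2 * Real.log M)
    simpa using h3
  have hev : ∀ᶠ D : ℕ in atTop, (m : ℝ) * θ' ≤ 2 * Real.log M +
      ((2 * Real.log (2 * K) + θ') / D + 2 * (Real.log (D : ℝ) / (D : ℝ))) := by
    filter_upwards [eventually_ge_atTop 1] with D hD1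
    have h := hD D hD1
    have hD0 : (0 : ℝ) < D := by exact_mod_cast hD1
    have hlog2 : Real.log (2 * K * D) = Real.log (2 * K) + Real.log D :=
      Real.log_mul (by positivity) (by positivity)
    rw [hlog2] at h
    have hsplit : 2 * Real.log M + ((2 * Real.log (2 * K) + θ') / D + 2 * (Real.log (D : ℝ) / D))
        = 2 * Real.log M + (2 * (Real.log (2 * K) + Real.log D) + θ') / D := by
      field_simp
      ring
    rw [hsplit, ← sub_le_iff_le_add', le_div_iff₀ hD0]
    linarith
  exact ge_of_tendsto hlim hev

/-- **The basic arithmetic holonomy bound** (Calegari–Dimitrov–Tang 2024, Appendix §17,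
eq. (PZ final), holomorphic case `u = h = 1`), in division-free form: for `ℚ(x)`-linearly
independent `f₁,…,f_m ∈ ℚ⟦x⟧` of denominator type `b` (`fᵢ = Σ a i k/den b k · x^k`,
independence as injectivity of every `ψ_D`), `φ` holomorphic on `|z| < R₀` (`R₀ > 1`) with
`φ(0) = 0`, pullbacks `gᵢ = φ^*fᵢ` holomorphic there (`gᵢ(z) = Σ_k (a i k/den b k) φ(z)^k` near
`0`), and bounds `|φ| ≤ M` (`M ≥ 1`), `|gᵢ| ≤ G` on the unit circle:
`m · (log|φ'(0)| − Σ_j b_j) ≤ 2 · log M`; i.e. `m ≤ 2 sup_𝕋 log⁺|φ| / (log|φ'(0)| − Σ bⱼ)`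
when the denominator is positive (take `M = max(1, sup_𝕋|φ|)`).
[cite: CalegariDimitrovTang2024, Appendix §17 eq. (PZ final) (p. 130), case `u = h = 1`] -/
theorem holonomyBound_basic (b : Fin r → ℕ) (a : Fin m → ℕ → ℤ)
    (hindep : ∀ D : ℕ, LinearIndependent ℚ (genFamily b a D))
    {φ : ℂ → ℂ} {g : Fin m → ℂ → ℂ} {R₀ M G : ℝ} (hR₀ : 1 < R₀)
    (hφ : DifferentiableOn ℂ φ (ball (0 : ℂ) R₀)) (hφ0 : φ 0 = 0)
    (hg : ∀ i, DifferentiableOn ℂ (g i) (ball (0 : ℂ) R₀))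
    (hgerm : ∀ i, ∀ᶠ z in 𝓝 (0 : ℂ), HasSum (fun k => (cfOf b a i k : ℂ) * φ z ^ k) (g i z))
    (hM1 : 1 ≤ M) (hM : ∀ z : ℂ, ‖z‖ = 1 → ‖φ z‖ ≤ M)
    (hGz : ∀ i (z : ℂ), ‖z‖ = 1 → ‖g i z‖ ≤ G) :
    (m : ℝ) * (Real.log ‖deriv φ 0‖ - ∑ j, (b j : ℝ)) ≤ 2 * Real.log M :=
  holonomyBound_of_coeff_bound b a hindep (norm_nonneg _) hM1 fun D T _ c hc n hn => by
    have h := norm_coeff_combo_mul_pow_le (cfOf b a) c hR₀ hφ hφ0 hg hgerm hc hM1 hM hGz hn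
    rwa [Complex.norm_ratCast] at h

end HolonomyBound

end Literature.NumberTheory.Transcendental
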